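import Mathlib
import HarnessLib
import Summits.NavierStokesRegularity.NavierStokesRegularity.Theorems.UnthreadedDoorNetFluxDenseFiniteZeroScalarLiouville

/-!
# Route `UnthreadedDoor`, crux `PoloidalLiouville` (stmt-NavierStokesRegularity-1222), WALL W1 — crux idea «null-time» (ns-idea-14 g5,
# `Cruxes/PoloidalLiouville/NullTimeSketch.lean` v1.1): stub AE-6 `stub_nullTimeDenseFinite_of_analytic` (gauge transfer), PROVED (by name)

`NetFlux.nullTimeDenseFinite_of_analytic : <NullTime.NSSpatialAnalyticity → NullTime.NullTimeAnalyticScalarLiouvilleTypeI →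
NullTime.NullTimeDenseFiniteZeroScalarLiouvilleTypeI, every Prop unfolded to its body (offNullPred / analyticFinitePred / sphCrit /
ScalarLiouvilleTypeIOn as in p684266)>`: the GAUGE TRANSFER of the a.e.-time chain.  Given spatial analyticity of bounded ancient mild solutions
(HH-0, landed p682567) and Type-I scalar Liouville on the stratum «height-head condition at the times `t ∉ D`» for every closed null `D`, the
K3ᵃᵉ statement follows: pass to the explicit radial gauge `T̃ = T − T(·, x₀ + ‖· − x₀‖σ₀)` — analytic off `x₀` by HH-6a
(`analyticRadialGauge`, p682734), still obeying (E1) by HH-6b (`curledLawRadialGauge`, p683221), with the same tangential gradient (HH-6c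
`tangentialGrad_radialGauge'`), bounded, jointly smooth — apply the stratum statement to `T̃` with the SAME exceptional set `D`, transfer back.
The proof is ARM A g5's Theorems-side port of the line's HH-6 assembly (p684266, `denseFiniteZeroScalarLiouvilleTypeI_holds`) VERBATIM with
`t ∉ D →` threaded through the stratum hypothesis — credited, not re-invented.
In the sketch: `theorem stub_nullTimeDenseFinite_of_analytic : NSSpatialAnalyticity → NullTimeAnalyticScalarLiouvilleTypeI →
NullTimeDenseFiniteZeroScalarLiouvilleTypeI := Theorems.PoloidalLiouville.NetFlux.nullTimeDenseFinite_of_analytic`.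

HONEST LABEL: one mechanical stub of the a.e.-time chain (crux idea «null-time» v1.1, critic V19 PASS-WITH-PRICE; the chain's lever AE-2′ and
AE-4′ are OPEN); `PoloidalLiouville` (1222), C⁻, W1 and the summit stay OPEN; NO Navier–Stokes regularity statement is proved.
`--supports stmt-NavierStokesRegularity-1222 --as helper`.  [folklore]
-/

noncomputable section

-- the summit and its single sub-problem share the name (CONVENTIONS §1)
set_option linter.dupNamespace false

open Set Function Filter Topology InnerProductSpace MeasureTheory Metric
open scoped RealInnerProductSpace ContDiff

namespace Summit.NavierStokesRegularity.NavierStokesRegularity.Theorems.PoloidalLiouville.NetFlux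

open Literature.Analysis Literature.Analysis.FluidPDE

/-- **AE-6 (gauge transfer), proved**: HH-0 spatial analyticity + Type-I scalar Liouville on the a.e.-time height-head stratum ⟹ K3ᵃᵉ
`NullTimeDenseFiniteZeroScalarLiouvilleTypeI`.  Statement = the sketch's implication with every Prop unfolded; proof = ARM A's HH-6 gauge
assembly (p684266) with `t ∉ D →` threaded.  No NS regularity statement is proved. [folklore] -/
theorem nullTimeDenseFinite_of_analytic :
    (∀ v : ℝ → E3 → E3, IsBoundedAncientMildSolution 1 v → (∀ t < 0, AEStronglyMeasurable (v t) volume) →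
        ContDiffOn ℝ (⊤ : ℕ∞) (Function.uncurry v) (Iio 0 ×ˢ univ) →
        ∀ t < 0, AnalyticOnNhd ℝ (v t) (univ : Set E3)) →
    (∀ D : Set ℝ, IsClosed D → volume D = 0 →
      ∀ (v : ℝ → E3 → E3) (x₀ : E3) (T : ℝ → E3 → ℝ),
        (∃ C : ℝ, HasTypeITimeDecay C v) →
        IsBoundedAncientMildSolution 1 v →
        (∀ t < 0, AEStronglyMeasurable (v t) volume) →
        ContDiffOn ℝ (⊤ : ℕ∞) (uncurry v) (Iio 0 ×ˢ univ) →
        ContDiffOn ℝ (⊤ : ℕ∞) (uncurry T) (Iio 0 ×ˢ ({x₀}ᶜ : Set E3)) →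
        (∃ C : ℝ, ∀ t < 0, ∀ x, |T t x| ≤ C) →
        (∀ t < 0, ∀ x, curl (v t) x = cross (gradient (T t) x) (x - x₀)) →
        CurledLaw v x₀ T (Iio 0) →
        (∀ t < 0, t ∉ D →
          AnalyticOnNhd ℝ (v t) (univ : Set E3) ∧ AnalyticOnNhd ℝ (T t) ({x₀}ᶜ : Set E3) ∧
            Ioi (0 : ℝ) ⊆ closure {r : ℝ | 0 < r ∧
              {x : E3 | x ∈ Metric.sphere x₀ r ∧ cross (gradient (T t) x) (x - x₀) = 0}.Finite}) →
        ∀ t < 0, ∀ x, cross (gradient (T t) x) (x - x₀) = 0) →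
    ∀ (v : ℝ → E3 → E3) (x₀ : E3) (T : ℝ → E3 → ℝ),
      (∃ C : ℝ, HasTypeITimeDecay C v) →
      IsBoundedAncientMildSolution 1 v →
      (∀ t < 0, AEStronglyMeasurable (v t) volume) →
      ContDiffOn ℝ (⊤ : ℕ∞) (uncurry v) (Iio 0 ×ˢ univ) →
      ContDiffOn ℝ (⊤ : ℕ∞) (uncurry T) (Iio 0 ×ˢ ({x₀}ᶜ : Set E3)) →
      (∃ C : ℝ, ∀ t < 0, ∀ x, |T t x| ≤ C) →
      (∀ t < 0, ∀ x, curl (v t) x = cross (gradient (T t) x) (x - x₀)) →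
      CurledLaw v x₀ T (Iio 0) →
      (∃ D : Set ℝ, IsClosed D ∧ volume D = 0 ∧
        ∀ t < 0, t ∉ D → Ioi (0 : ℝ) ⊆ closure {r : ℝ | 0 < r ∧
          {x : E3 | x ∈ Metric.sphere x₀ r ∧ cross (gradient (T t) x) (x - x₀) = 0}.Finite}) →
      ∀ t < 0, ∀ x, cross (gradient (T t) x) (x - x₀) = 0 := by
  intro hh0 hK3 v x₀ T hC hB hm hsv hsT hTb hrep hE hD
  obtain ⟨D, hDc, hD0, hfin⟩ := hD
  -- (port of ARM A g5's HH-6 gauge assembly, p684266, with `t ∉ D →` threaded)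
  -- the gauge direction: a unit vector
  obtain ⟨σ₀, hσ₀⟩ : ∃ σ₀ : E3, ‖σ₀‖ = 1 :=
    ⟨EuclideanSpace.single (0 : Fin 3) (1 : ℝ), by simp⟩
  have hσ₀ne : σ₀ ≠ 0 := by
    intro h; rw [h, norm_zero] at hσ₀; exact zero_ne_one hσ₀
  have hray : ∀ r : ℝ, r ≠ 0 → x₀ + r • σ₀ ≠ x₀ := by
    intro r hr h
    have h' : r • σ₀ = 0 := by simpa using h
    exact smul_ne_zero hr hσ₀ne h'
  -- the radial summand and the gauged potential
  set c : ℝ → ℝ → ℝ := fun t r => -T t (x₀ + r • σ₀) with hcdef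
  set T' : ℝ → E3 → ℝ := fun t x => T t x + c t ‖x - x₀‖ with hT'def
  have hTslice : ∀ t < 0, ContDiffOn ℝ (⊤ : ℕ∞) (T t) ({x₀}ᶜ : Set E3) := by
    intro t ht
    have h1 : ContDiffOn ℝ (⊤ : ℕ∞) (fun x : E3 => ((t, x) : ℝ × E3)) ({x₀}ᶜ : Set E3) :=
      contDiffOn_const.prodMk contDiffOn_id
    have h2 : MapsTo (fun x : E3 => ((t, x) : ℝ × E3)) ({x₀}ᶜ : Set E3) (Iio 0 ×ˢ ({x₀}ᶜ : Set E3)) :=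
      fun x hx => ⟨ht, hx⟩
    exact (hsT.comp h1 h2).congr (fun x _ => rfl)
  have hTdiff : ∀ t < 0, ∀ z : E3, z ≠ x₀ → DifferentiableAt ℝ (T t) z := by
    intro t ht z hz
    exact ((hTslice t ht).differentiableOn (by simp)).differentiableAt (isOpen_compl_singleton.mem_nhds hz)
  have hcdiff : ∀ t < 0, ∀ r : ℝ, r ≠ 0 → DifferentiableAt ℝ (c t) r := by
    intro t ht r hr
    have h1 : DifferentiableAt ℝ (fun r : ℝ => x₀ + r • σ₀) r := by fun_prop
    exact ((hTdiff t ht _ (hray r hr)).comp r h1).neg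
  -- HH-6c: tangential gradients agree
  have hcross : ∀ t < 0, ∀ x : E3,
      cross (gradient (T' t) x) (x - x₀) = cross (gradient (T t) x) (x - x₀) := by
    intro t ht x
    by_cases hx : x = x₀
    · rw [hx, sub_self, cross_zero_right, cross_zero_right]
    · exact tangentialGrad_radialGauge' (T t) (c t) x₀ x hx (hTdiff t ht x hx)
        (hcdiff t ht _ (norm_ne_zero_iff.2 (sub_ne_zero.2 hx)))
  -- (α) joint smoothness of `T'` off `x₀`
  have hg : ContDiffOn ℝ (⊤ : ℕ∞) (fun p : ℝ × E3 => ((p.1, x₀ + ‖p.2 - x₀‖ • σ₀) : ℝ × E3))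
      (Iio 0 ×ˢ ({x₀}ᶜ : Set E3)) := by
    have hn : ContDiffOn ℝ (⊤ : ℕ∞) (fun p : ℝ × E3 => ‖p.2 - x₀‖) (Iio 0 ×ˢ ({x₀}ᶜ : Set E3)) :=
      (contDiffOn_snd.sub contDiffOn_const).norm ℝ (fun p hp => sub_ne_zero.2 hp.2)
    exact contDiffOn_fst.prodMk (contDiffOn_const.add (hn.smul contDiffOn_const))
  have hgmaps : MapsTo (fun p : ℝ × E3 => ((p.1, x₀ + ‖p.2 - x₀‖ • σ₀) : ℝ × E3)) (Iio 0 ×ˢ ({x₀}ᶜ : Set E3))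
      (Iio 0 ×ˢ ({x₀}ᶜ : Set E3)) :=
    fun p hp => ⟨hp.1, hray _ (norm_ne_zero_iff.2 (sub_ne_zero.2 hp.2))⟩
  have hsT' : ContDiffOn ℝ (⊤ : ℕ∞) (uncurry T') (Iio 0 ×ˢ ({x₀}ᶜ : Set E3)) :=
    (hsT.add (hsT.comp hg hgmaps).neg).congr (fun p _ => rfl)
  -- (β) boundedness
  have hTb' : ∃ C : ℝ, ∀ t < 0, ∀ x, |T' t x| ≤ C := by
    obtain ⟨C, hCb⟩ := hTb
    refine ⟨C + C, fun t ht x => ?_⟩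
    have h1 := hCb t ht x
    have h2 := hCb t ht (x₀ + ‖x - x₀‖ • σ₀)
    show |T t x + -T t (x₀ + ‖x - x₀‖ • σ₀)| ≤ C + C
    calc |T t x + -T t (x₀ + ‖x - x₀‖ • σ₀)| ≤ |T t x| + |-T t (x₀ + ‖x - x₀‖ • σ₀)| := abs_add_le _ _
      _ ≤ C + C := by rw [abs_neg]; exact add_le_add h1 h2
  -- (γ) representation of the vorticity
  have hrep' : ∀ t < 0, ∀ x, curl (v t) x = cross (gradient (T' t) x) (x - x₀) := by
    intro t ht x; rw [hcross t ht x]; exact hrep t ht x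
  -- (δ) the curled law (E1), by HH-6b
  have hcg : ContDiffOn ℝ (⊤ : ℕ∞) (fun p : ℝ × ℝ => ((p.1, x₀ + p.2 • σ₀) : ℝ × E3)) (Iio 0 ×ˢ Ioi (0 : ℝ)) :=
    contDiffOn_fst.prodMk (contDiffOn_const.add (contDiffOn_snd.smul contDiffOn_const))
  have hcmaps : MapsTo (fun p : ℝ × ℝ => ((p.1, x₀ + p.2 • σ₀) : ℝ × E3)) (Iio 0 ×ˢ Ioi (0 : ℝ))
      (Iio 0 ×ˢ ({x₀}ᶜ : Set E3)) :=
    fun p hp => ⟨hp.1, hray _ (ne_of_gt hp.2)⟩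
  have hc : ContDiffOn ℝ (⊤ : ℕ∞) (uncurry c) (Iio 0 ×ˢ Ioi (0 : ℝ)) :=
    ((hsT.comp hcg hcmaps).neg).congr (fun p _ => rfl)
  have hE' : CurledLaw v x₀ T' (Iio 0) := curledLawRadialGauge v x₀ T c (Iio 0) isOpen_Iio hsv hsT hc hE
  -- (ε) the a.e.-time stratum for `T'`: analytic slices (HH-0, HH-6a) and the same dense finite-zero radii off `D` (HH-6c)
  have hS : ∀ t < 0, t ∉ D →
      AnalyticOnNhd ℝ (v t) (univ : Set E3) ∧ AnalyticOnNhd ℝ (T' t) ({x₀}ᶜ : Set E3) ∧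
        Ioi (0 : ℝ) ⊆ closure {r : ℝ | 0 < r ∧
          {x : E3 | x ∈ Metric.sphere x₀ r ∧ cross (gradient (T' t) x) (x - x₀) = 0}.Finite} := by
    intro t ht htD
    have hva : AnalyticOnNhd ℝ (v t) (univ : Set E3) := hh0 v hB hm hsv t ht
    refine ⟨hva, ?_, ?_⟩
    · have h := analyticRadialGauge (v t) x₀ σ₀ (T t) hσ₀ hva (hTslice t ht) (hrep t ht)
      have heq : (fun x => T t x - T t (x₀ + ‖x - x₀‖ • σ₀)) = T' t := by
        funext x; simp [hT'def, hcdef, sub_eq_add_neg]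
      rw [heq] at h
      exact h
    · have hset : {r : ℝ | 0 < r ∧ {x : E3 | x ∈ Metric.sphere x₀ r ∧ cross (gradient (T' t) x) (x - x₀) = 0}.Finite}
          = {r : ℝ | 0 < r ∧ {x : E3 | x ∈ Metric.sphere x₀ r ∧ cross (gradient (T t) x) (x - x₀) = 0}.Finite} := by
        ext r
        simp only [mem_setOf_eq, hcross t ht]
      rw [hset]
      exact hfin t ht htD
  -- apply the a.e.-time stratum statement to `T'` (same `D`) and transfer the conclusion back (HH-6c)
  intro t ht x
  have h := hK3 D hDc hD0 v x₀ T' hC hB hm hsv hsT' hTb' hrep' hE' hS t ht x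
  rwa [hcross t ht x] at h

end Summit.NavierStokesRegularity.NavierStokesRegularity.Theorems.PoloidalLiouville.NetFlux

end
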